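import Summits.FinalStateConjecture.FinalStateConjecture.Theorems.SeamedChartsExhaust.Negative.NoHoleCase

/-!
# Route StarvedNecks — crux `SeamedChartsExhaust`, line `wide-anchoring` (generation 2): STUB 1, FIRST CONTACT

Stub `stub_firstContact` of the checked skeleton `Cruxes/SeamedChartsExhaust/Lines/wide-anchoring.lean`
(crux item stmt-FinalStateConjecture-13551, decl `Theses.StarvedNecks.SeamedChartsExhaust`), proved with
its registered signature, verbatim.

For a flat-late coordinate point `y` of an `N`-black-hole final-state decomposition `d`
(`τ₀ < y⁰ ≤ τ₁`) follow the LAB RAY `σ ↦ y + σ e₀`, `σ ∈ [0, τ₁ − y⁰]`. The CONTACT SET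
`C = {σ ∈ [0, τ₁ − y⁰] | ∃ k, rₖ(y + σe₀) ≤ Rₖ(tₖ(y + σe₀))}` (closed: finitely many holes, `rₖ`, `tₖ`
continuous on `E4`, `Rₖ` continuous) is either empty — then the whole ray lies in the flat domain `U`
(SEAMED (8) read contrapositively keeps every ray point outside every flat tube, and the structure field
`setOf_lt_excision_subset_flatDomain` puts it in `U`), the flat chart's `e₀`-lines are future causal
curves there (HonestCore (d) + the adapter `line_mem_causalFuture`), and the ray ends on the flat slab
`{x⁰ = τ₁}` — or it has a least element `u` (FIRST CONTACT), before which there is no contact and at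
which, by continuity, every `rⱼ − Rⱼ ∘ tⱼ` is still `≥ 0 > −2`, so the ray up to and including the
contact point `c = y + u e₀` lies in `U` and `Φ y ≤ Φ c`, `τ₀ < c⁰ ≤ τ₁`, `rₖ(c) ≤ Rₖ(tₖ c)`.

This is the one place of the crux where the future orientation of the flat chart (HonestCore (d)) is
consumed (cf. the landed negative lemma `Theorems/SeamedChartsExhaust/Negative/WithoutFutureOrientation.lean`).

Contents: `exists_collar` (an open set containing a coordinate segment contains a parameter collar —
only openness at the two endpoints is used), `flatRay_mem_causalPast` (the flow along the lab ray, via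
the landed adapter `Negative.line_mem_causalFuture` of `Theorems/SeamedChartsExhaust/Negative/NoHoleCase.lean`:
coordinate lines through a chart on an open subset of `E4` with future-directed `dΦ(v)` are causal
curves), `stub_firstContact`.

References: B. O'Neill, *Semi-Riemannian geometry*, Academic Press 1983, Ch. 14, pp. 402–403;
M. Dafermos, G. Holzegel, I. Rodnianski, M. Taylor, arXiv:2104.08222, §1 (late-time charts).
-/

noncomputable section

set_option linter.dupNamespace false

open Set Filter Topology Function TopologicalSpace
open scoped Manifold ContDiff ENNReal Topology
open Literature.Geometry.Lorentzian
open Summit.FinalStateConjecture.FinalStateConjecture.Theorems.SeamedChartsExhaust.Negative (line_mem_causalFuture)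

namespace Summit.FinalStateConjecture.FinalStateConjecture.Theorems.SeamedChartsExhaust.WideAnchoring

variable {𝓢 : Spacetime.{0} 4}

/-- **Parameter collar.** If the coordinate segment `σ ↦ y + σ v`, `σ ∈ [0, u]`, lies in the open set
`U ⊆ E4`, then so does the slightly longer segment `σ ∈ [−ε, u + ε]` for some `ε > 0` (openness of `U`
at the two endpoints). [folklore] -/
theorem exists_collar {U : Opens E4} {y v : E4} {u : ℝ} (hu : 0 ≤ u)
    (hmem : ∀ σ ∈ Icc 0 u, y + σ • v ∈ U) :
    ∃ ε : ℝ, 0 < ε ∧ ∀ σ ∈ Icc (-ε) (u + ε), y + σ • v ∈ U := by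
  have hcont : Continuous fun σ : ℝ ↦ y + σ • v :=
    continuous_const.add (continuous_id.smul continuous_const)
  have h0 : ∀ᶠ σ in 𝓝 (0 : ℝ), y + σ • v ∈ U :=
    hcont.continuousAt.preimage_mem_nhds (U.isOpen.mem_nhds (hmem 0 ⟨le_rfl, hu⟩))
  have h1 : ∀ᶠ σ in 𝓝 u, y + σ • v ∈ U :=
    hcont.continuousAt.preimage_mem_nhds (U.isOpen.mem_nhds (hmem u ⟨hu, le_rfl⟩))
  obtain ⟨ε₀, hε₀, hb0⟩ := Metric.eventually_nhds_iff.mp h0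
  obtain ⟨ε₁, hε₁, hb1⟩ := Metric.eventually_nhds_iff.mp h1
  refine ⟨min ε₀ ε₁ / 2, by positivity, fun σ hσ ↦ ?_⟩
  have hmin0 := min_le_left ε₀ ε₁
  have hmin1 := min_le_right ε₀ ε₁
  by_cases hσ0 : σ < 0
  · apply hb0
    rw [Real.dist_eq, sub_zero, abs_lt]
    constructor <;> linarith [hσ.1]
  by_cases hσu : u < σ
  · apply hb1
    rw [Real.dist_eq, abs_lt]
    constructor <;> linarith [hσ.2]
  · push Not at hσ0 hσu
    exact hmem σ ⟨hσ0, hσu⟩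

/-- **The flow along the lab ray.** If the lab ray `σ ↦ y + σ e₀`, `σ ∈ [0, u]`, from a flat-late
coordinate point `y` (`τ₀ < y⁰`) stays in the flat domain `U`, then `Φ y ≤ Φ(y + u e₀)`: by
HonestCore (d) the velocity `dΦ(e₀)` is future-directed at every ray point (all have lab time
`> τ₀`), so the adapter `Negative.line_mem_causalFuture` applies with the collar of `exists_collar`.
O'Neill 1983, Ch. 14, p. 402. [folklore] -/
theorem flatRay_mem_causalPast {O : Set 𝓢.carrier} (d : FinalStateDecomposition 𝓢 O 2)
    (hd : ∀ y : d.flatDomain, d.τ₀ < y.1 0 →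
      𝓢.timeOrientation.IsFutureDirected (mfderiv 𝓘(ℝ, E4) (𝓡 4) d.flatChart y (E4.basisVector 0)))
    (y : d.flatDomain) (hy₀ : d.τ₀ < y.1 0) {u : ℝ} (hu : 0 ≤ u)
    (hmem : ∀ σ ∈ Icc 0 u, y.1 + σ • E4.basisVector 0 ∈ d.flatDomain) :
    d.flatChart y ∈ 𝓢.metric.causalPast 𝓢.timeOrientation
      {d.flatChart ⟨y.1 + u • E4.basisVector 0, hmem u ⟨hu, le_rfl⟩⟩} := by
  obtain ⟨ε, hε, hmem'⟩ := exists_collar hu hmem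
  have hflow := line_mem_causalFuture d.isLateChart_flat.contMDiff (E4.basisVector 0) y.1 y.2 hu hε
    hmem' (by
      rintro z ⟨σ, hσ, hzσ⟩
      apply hd
      show d.τ₀ < z.1 0
      rw [← hzσ]
      have h1 : 0 ≤ σ := hσ.1
      simp
      linarith)
  exact LorentzianMetric.mem_causalPast_of_mem_causalFuture hflow

/-- **STUB 1 — FIRST CONTACT** (registered signature, verbatim; the ONLY consumer of HonestCore (d)).
For a flat-late `y` with `τ₀ < y⁰ ≤ τ₁` follow the lab ray `σ ↦ y + σ e₀`, `σ ∈ [0, τ₁ − y⁰]`. The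
contact set `C = {σ ∈ [0, τ₁ − y⁰] | ∃ k, rₖ(y + σe₀) ≤ Rₖ(tₖ(y + σe₀))}` is closed (finitely many `k`;
`rₖ`, `tₖ` continuous on `E4`: `Kerr.continuous_radius`, `continuous_poincareInv`; `Rₖ` continuous:
`hR`). As long as every `rₖ > Rₖ(tₖ) − 2` along the ray, the ray point lies in the flat domain `U`
(`h8` read contrapositively gives `ρₖ(x⁰) < rₖ`, then the structure field
`setOf_lt_excision_subset_flatDomain`; the lab time is `y⁰ + σ > τ₀`). Hence: `C = ∅` ⇒ the whole ray
is in `U` and the flow (`flatRay_mem_causalPast`, from `hd`) reaches the flat slab `{x⁰ = τ₁}` — LEFT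
disjunct; `C ≠ ∅` ⇒ `u := min C` exists (`IsClosed.csInf_mem`), there is no contact strictly before
`u`, and at `u` (if `u > 0`) every `rⱼ − Rⱼ ∘ tⱼ ≥ 0 > −2` by continuity, so the ray up to the contact
point `c = y + u e₀` is in `U` and the flow gives `Φ y ≤ Φ c`, `τ₀ < c⁰ = y⁰ + u ≤ τ₁`,
`rₖ(c) ≤ Rₖ(tₖ c)` — RIGHT disjunct. Clauses: HonestCore (d) = `hd`, SEAMED (1)-continuity = `hR`,
SEAMED (8) = `h8`. O'Neill 1983, Ch. 14, p. 402. [folklore] -/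
theorem stub_firstContact (𝓢 : Spacetime.{0} 4) (O : Set 𝓢.carrier)
    (d : FinalStateDecomposition 𝓢 O 2) (R : Fin d.N → ℝ → ℝ)
    (hd : ∀ y : d.flatDomain, d.τ₀ < y.1 0 →
      𝓢.timeOrientation.IsFutureDirected (mfderiv 𝓘(ℝ, E4) (𝓡 4) d.flatChart y (E4.basisVector 0)))
    (hR : ∀ i, Continuous (R i))
    (h8 : ∀ j (y : E4), d.τ₀ ≤ y 0 → (d.background j).radius y ≤ d.excision j (y 0) →
      (d.background j).radius y + 2 ≤ R j ((d.background j).time y))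
    (τ₁ : ℝ) (y : d.flatDomain) (hy₀ : d.τ₀ < y.1 0) (hy₁ : y.1 0 ≤ τ₁) :
    d.flatChart y ∈ 𝓢.metric.causalPast 𝓢.timeOrientation
        (d.flatChart '' (Minkowski.backgroundOn d.flatDomain).timeSlab τ₁) ∨
      ∃ (c : d.flatDomain) (k : Fin d.N), d.τ₀ < c.1 0 ∧ c.1 0 ≤ τ₁ ∧
        (d.background k).radius c.1 ≤ R k ((d.background k).time c.1) ∧
        d.flatChart y ∈ 𝓢.metric.causalPast 𝓢.timeOrientation {d.flatChart c} := by
  -- the lab ray and the functions along it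
  set e₀ : E4 := E4.basisVector 0 with he₀
  set s : ℝ := τ₁ - y.1 0 with hs
  have hs0 : 0 ≤ s := by rw [hs]; linarith
  have hray0 : ∀ σ : ℝ, (y.1 + σ • e₀) 0 = y.1 0 + σ := fun σ ↦ by simp [he₀]
  have hcont : Continuous fun σ : ℝ ↦ y.1 + σ • e₀ :=
    continuous_const.add (continuous_id.smul continuous_const)
  have hc0 : Continuous fun x : E4 ↦ x 0 := PiLp.continuous_apply 2 _ 0
  have ht : ∀ k, Continuous fun σ : ℝ ↦ (d.background k).time (y.1 + σ • e₀) := fun k ↦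
    (hc0.comp (continuous_poincareInv _ _)).comp hcont
  have hr : ∀ k, Continuous fun σ : ℝ ↦ (d.background k).radius (y.1 + σ • e₀) := fun k ↦
    ((Kerr.continuous_radius _).comp (continuous_poincareInv _ _)).comp hcont
  -- a ray point all of whose rest-frame radii exceed `Rₖ(tₖ) − 2` lies in the flat domain
  have hinU : ∀ σ : ℝ, 0 ≤ σ →
      (∀ k, R k ((d.background k).time (y.1 + σ • e₀)) - 2 < (d.background k).radius (y.1 + σ • e₀)) →
      y.1 + σ • e₀ ∈ d.flatDomain := by
    intro σ hσ hk
    apply d.setOf_lt_excision_subset_flatDomain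
    refine ⟨?_, fun k ↦ ?_⟩
    · show d.τ₀ < (y.1 + σ • e₀) 0
      rw [hray0]
      linarith
    · show d.excision k ((y.1 + σ • e₀) 0) < (d.background k).radius (y.1 + σ • e₀)
      by_contra hle
      push Not at hle
      have hτ : d.τ₀ ≤ (y.1 + σ • e₀) 0 := by rw [hray0]; linarith
      have := h8 k (y.1 + σ • e₀) hτ hle
      linarith [hk k]
  -- the contact set
  set C : Set ℝ := {σ | σ ∈ Icc 0 s ∧
    ∃ k, (d.background k).radius (y.1 + σ • e₀) ≤ R k ((d.background k).time (y.1 + σ • e₀))} with hC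
  have hCeq : C = Icc 0 s ∩ ⋃ k, {σ | (d.background k).radius (y.1 + σ • e₀) ≤
      R k ((d.background k).time (y.1 + σ • e₀))} := by
    ext σ
    simp only [hC, mem_setOf_eq, mem_inter_iff, mem_iUnion]
  have hCclosed : IsClosed C := by
    rw [hCeq]
    exact isClosed_Icc.inter (isClosed_iUnion_of_finite fun k ↦ isClosed_le (hr k) ((hR k).comp (ht k)))
  by_cases hCne : C.Nonempty
  · -- FIRST CONTACT at `u = min C`
    right
    have hCbdd : BddBelow C := ⟨0, fun σ hσ ↦ hσ.1.1⟩
    set u : ℝ := sInf C with hu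
    have huC : u ∈ C := hCclosed.csInf_mem hCne hCbdd
    obtain ⟨⟨hu0, hus⟩, k, hk⟩ := huC
    -- no contact strictly before `u`
    have hbefore : ∀ σ, 0 ≤ σ → σ < u →
        ∀ j, R j ((d.background j).time (y.1 + σ • e₀)) < (d.background j).radius (y.1 + σ • e₀) := by
      intro σ hσ0 hσu j
      by_contra hle
      push Not at hle
      have hσC : σ ∈ C := ⟨⟨hσ0, hσu.le.trans hus⟩, j, hle⟩
      exact absurd (csInf_le hCbdd hσC) (not_le.mpr hσu)
    -- at `u` every `rⱼ − Rⱼ ∘ tⱼ` is still nonnegative (or `u = 0`), so the ray up to `u` is in `U`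
    have hmem : ∀ σ ∈ Icc 0 u, y.1 + σ • e₀ ∈ d.flatDomain := by
      intro σ hσ
      rcases hσ.2.lt_or_eq with hlt | heq
      · exact hinU σ hσ.1 fun j ↦ by linarith [hbefore σ hσ.1 hlt j]
      · rw [heq]
        rcases hu0.lt_or_eq with hupos | hu0'
        · refine hinU u hu0 fun j ↦ ?_
          have hge : R j ((d.background j).time (y.1 + u • e₀)) ≤ (d.background j).radius (y.1 + u • e₀) := by
            have hlim : Tendsto (fun σ : ℝ ↦ (d.background j).radius (y.1 + σ • e₀) -
                R j ((d.background j).time (y.1 + σ • e₀))) (𝓝[<] u)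
                (𝓝 ((d.background j).radius (y.1 + u • e₀) - R j ((d.background j).time (y.1 + u • e₀)))) :=
              (((hr j).sub ((hR j).comp (ht j))).tendsto u).mono_left nhdsWithin_le_nhds
            have hev : ∀ᶠ σ in 𝓝[<] u, (0 : ℝ) ≤ (d.background j).radius (y.1 + σ • e₀) -
                R j ((d.background j).time (y.1 + σ • e₀)) := by
              filter_upwards [Ioo_mem_nhdsLT hupos] with σ hσ
              linarith [hbefore σ hσ.1.le hσ.2 j]
            linarith [ge_of_tendsto hlim hev]
          linarith
        · rw [← hu0']
          simp
    -- the contact point and the flow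
    refine ⟨⟨y.1 + u • e₀, hmem u ⟨hu0, le_rfl⟩⟩, k, ?_, ?_, hk, flatRay_mem_causalPast d hd y hy₀ hu0 hmem⟩
    · show d.τ₀ < (y.1 + u • e₀) 0
      rw [hray0]
      linarith
    · show (y.1 + u • e₀) 0 ≤ τ₁
      rw [hray0]
      linarith
  · -- NO CONTACT: the ray reaches the flat slab inside `U`
    left
    have hmem : ∀ σ ∈ Icc 0 s, y.1 + σ • e₀ ∈ d.flatDomain := by
      intro σ hσ
      refine hinU σ hσ.1 fun j ↦ ?_
      have hlt : R j ((d.background j).time (y.1 + σ • e₀)) < (d.background j).radius (y.1 + σ • e₀) := by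
        by_contra hle
        push Not at hle
        exact hCne ⟨σ, hσ, j, hle⟩
      linarith
    have hz : (⟨y.1 + s • e₀, hmem s ⟨hs0, le_rfl⟩⟩ : d.flatDomain) ∈
        (Minkowski.backgroundOn d.flatDomain).timeSlab τ₁ := by
      show (y.1 + s • e₀) 0 = τ₁
      rw [hray0, hs]
      ring
    have hzS : d.flatChart ⟨y.1 + s • e₀, hmem s ⟨hs0, le_rfl⟩⟩ ∈
        d.flatChart '' (Minkowski.backgroundOn d.flatDomain).timeSlab τ₁ := ⟨_, hz, rfl⟩
    exact LorentzianMetric.causalFuture_mono (singleton_subset_iff.mpr hzS)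
      (flatRay_mem_causalPast d hd y hy₀ hs0 hmem)

end Summit.FinalStateConjecture.FinalStateConjecture.Theorems.SeamedChartsExhaust.WideAnchoring

end
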